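import Mathlib
import Summits.Ventures.PercRepro2.V2SP
import Summits.Ventures.PercRepro2.HallOffFrame
import Summits.Ventures.PercRepro2.HallOffAxis
import Summits.Ventures.PercRepro2.Tail2DCount
import Summits.Ventures.PercRepro2.Tail2DThreePoint
import Summits.Ventures.PercRepro2.Tail2DP2Series
import Summits.Ventures.PercRepro2.Tail2DDisjointPaths
import Summits.Ventures.PercRepro2.Tail2DP2SeriesSP
import Summits.Ventures.PercRepro2.Tail2DAxisUnimodal
import Summits.Ventures.PercRepro2.Tail2DOffAxis31
import Summits.Ventures.PercRepro2.Tail2DRowOne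

/-!
# The row `i = 0` of STEP on every series–parallel network: `#{r = 0, b ≥ j} ≤ #{r = 1, b ≥ j−1}`
for every `j ≥ 2` (seat mine-b, cell pub-perc-repro2; MINE-B.md §37.5–37.6)

STEP(i, j) (registry §7.6, §10.3) is `H(i,j) ≤ H(i+1,j−1)` for `j ≥ i+2`, `H(i,j) = #{r = i ∧ b ≥ j}`: one
unit of flow handed from blue to red with the red level pinned.  STEP implies the whole anti-diagonal
unimodality `T(a,j) ≤ T(a−1,j+1)` by summation (§10.3), and was known on series–parallel networks only
for compositions of strands of edge-connectivity `≤ 2` (`StepClosure.lean`).  Here the row `i = 0` is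
proved for EVERY pattern of the grammar and every `j ≥ 2` (`step_row_zero`), by the method of
`Tail2DRowOne.lean`: in the weight vocabulary `psi i j r b = [r = i+1 ∧ b ≥ j−1] − [r = i ∧ b ≥ j]`, the
weight of a parallel composition dominates pointwise three products (count-valid weight of one factor) ×
(non-negative weight of the other) (`psi_zero_par_ge`):

  `psi 0 j (r+r') (b+b') ≥ [r' = 0 ∧ b' ≤ j−1]·psi 0 (j−b') r b + [r' = 0 ∧ b' ≥ j]·psi 0 j r b
                           + [r = 0 ∧ b ≤ j−1]·psi 0 (j−b) r' b'`,

the hypotheses being the row itself at the levels `2 … j` (the induction hypothesis, all `j` at once)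
and the level `1`, whose count equals the count of the level `2` by the colour swap
(`sum_psi_zero_one`).  The series step (`step_ser`) is the identity
`H''(i,j) = H₁(i,j)·T₂(i,j) + T₁(i+1,j)·H₂(i,j)` together with the anti-diagonal comparisons
`T(0,j) ≤ T(1,j−1)` (the axis theorem) and `T(1,j) ≤ T(2,j−1)` (the row `j = 1`, `t_row1`) of the factors;
the atoms have flows `≤ 1`.
-/

namespace Summit.Ventures.PercRepro2.Tail2D

open V2Closure

/-- the STEP weight `psi i j r b = [r = i+1 ∧ b ≥ j−1] − [r = i ∧ b ≥ j]` (with `b ≥ j−1` written `j ≤ b+1`) -/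
def psi (i j r b : ℕ) : ℤ :=
  (if r = i + 1 ∧ j ≤ b + 1 then 1 else 0) - (if r = i ∧ j ≤ b then 1 else 0)

section Counts

variable (s : V2Closure.SP)

/-- the count of the STEP weight: `Σ psi i j = #{r = i+1 ∧ b+1 ≥ j} − #{r = i ∧ b ≥ j}` -/
lemma sum_psi_eq (i j : ℕ) :
    ∑ x, psi i j (s.rLab x) (s.bLab x)
      = ((Finset.univ.filter (fun y : s.Conf => s.rLab y = i + 1 ∧ j ≤ s.bLab y + 1)).card : ℤ)
        - ((Finset.univ.filter (fun y : s.Conf => s.rLab y = i ∧ j ≤ s.bLab y)).card : ℤ) := by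
  rw [Finset.card_filter, Finset.card_filter]
  push_cast
  rw [← Finset.sum_sub_distrib]
  refine Finset.sum_congr rfl (fun y _ => ?_)
  unfold psi
  split_ifs <;> omega

/-- STEP(i, j) as a count inequality and as the sign of the count of `psi i j` -/
lemma step_iff (i j : ℕ) :
    (Finset.univ.filter (fun y : s.Conf => s.rLab y = i ∧ j ≤ s.bLab y)).card
        ≤ (Finset.univ.filter (fun y : s.Conf => s.rLab y = i + 1 ∧ j ≤ s.bLab y + 1)).card
      ↔ 0 ≤ ∑ x, psi i j (s.rLab x) (s.bLab x) := by
  rw [sum_psi_eq]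
  constructor <;> intro h <;> omega

/-- the cell swap difference `[r = p ∧ b = q] − [r = q ∧ b = p]` has count `0` (the colour swap) -/
lemma sum_dcell_zero (p q : ℕ) :
    ∑ x, ((if s.rLab x = p ∧ s.bLab x = q then (1 : ℤ) else 0) - (if s.rLab x = q ∧ s.bLab x = p then 1 else 0)) = 0 := by
  rw [Finset.sum_sub_distrib]
  have h := card_swap s (fun r b => r = q ∧ b = p)
  rw [Finset.card_filter, Finset.card_filter] at h
  have e : ∑ x, (if s.rLab x = p ∧ s.bLab x = q then (1 : ℤ) else 0)
      = ∑ x, (if s.rLab x = q ∧ s.bLab x = p then (1 : ℤ) else 0) := by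
    have h' : ((∑ x, if s.bLab x = q ∧ s.rLab x = p then (1 : ℕ) else 0) : ℤ)
        = ((∑ x, if s.rLab x = q ∧ s.bLab x = p then (1 : ℕ) else 0) : ℤ) := by exact_mod_cast h
    push_cast at h'
    rw [← h']
    refine Finset.sum_congr rfl (fun x _ => ?_)
    (try split_ifs) <;> omega
  rw [e, sub_self]

/-- the level `1` of the row `i = 0` has the count of the level `2`: `psi 0 1 − psi 0 2` is the cell swap
difference `[r = 1 ∧ b = 0] − [r = 0 ∧ b = 1]` -/
lemma sum_psi_zero_one :
    ∑ x, psi 0 1 (s.rLab x) (s.bLab x) = ∑ x, psi 0 2 (s.rLab x) (s.bLab x) := by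
  have h := sum_dcell_zero s 1 0
  have e : ∑ x, psi 0 1 (s.rLab x) (s.bLab x)
      = ∑ x, psi 0 2 (s.rLab x) (s.bLab x)
        + ∑ x, ((if s.rLab x = 1 ∧ s.bLab x = 0 then (1 : ℤ) else 0) - (if s.rLab x = 0 ∧ s.bLab x = 1 then 1 else 0)) := by
    rw [← Finset.sum_add_distrib]
    refine Finset.sum_congr rfl (fun x _ => ?_)
    unfold psi
    (try split_ifs) <;> omega
  rw [e, h, add_zero]

/-- the row `i = 0` at level `2` is the axis theorem `T(2,0) ≤ T(1,1)` (the colour swap): `0 ≤ Σ psi 0 2` -/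
lemma sum_psi_zero_two_nonneg : 0 ≤ ∑ x, psi 0 2 (s.rLab x) (s.bLab x) := by
  rw [← step_iff]
  -- `#{r = 0 ∧ b ≥ 2} ≤ #{r = 1 ∧ b ≥ 1}`: swap the left side to `#{b = 0 ∧ r ≥ 2}` and use `vt_le_rq` at `k = 2`
  -- via the axis theorem: `#{r ≥ 2} ≤ #{r ≥ 1 ∧ b ≥ 1}` ... we argue through the tails directly
  have h := tail_axis_unimodal s 1   -- #{2 ≤ r} ≤ #{1 ≤ r ∧ 1 ≤ b}
  rw [show (1 : ℕ) + 1 = 2 from rfl] at h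
  have e1 : (Finset.univ.filter (fun y : s.Conf => 2 ≤ s.rLab y)).card
      = (Finset.univ.filter (fun y : s.Conf => 2 ≤ s.rLab y ∧ s.bLab y = 0)).card
        + (Finset.univ.filter (fun y : s.Conf => 2 ≤ s.rLab y ∧ 1 ≤ s.bLab y)).card := by
    rw [Finset.card_filter, Finset.card_filter, Finset.card_filter, ← Finset.sum_add_distrib]
    refine Finset.sum_congr rfl (fun y _ => ?_); split_ifs <;> omega
  have e2 : (Finset.univ.filter (fun y : s.Conf => 1 ≤ s.rLab y ∧ 1 ≤ s.bLab y)).card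
      = (Finset.univ.filter (fun y : s.Conf => s.rLab y = 1 ∧ 1 ≤ s.bLab y)).card
        + (Finset.univ.filter (fun y : s.Conf => 2 ≤ s.rLab y ∧ 1 ≤ s.bLab y)).card := by
    rw [Finset.card_filter, Finset.card_filter, Finset.card_filter, ← Finset.sum_add_distrib]
    refine Finset.sum_congr rfl (fun y _ => ?_); split_ifs <;> omega
  have e3 : (Finset.univ.filter (fun y : s.Conf => s.rLab y = 0 ∧ 2 ≤ s.bLab y)).card
      = (Finset.univ.filter (fun y : s.Conf => 2 ≤ s.rLab y ∧ s.bLab y = 0)).card := by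
    rw [← card_swap s (fun r b => 2 ≤ r ∧ b = 0)]
    congr 1; ext y; simp only [Finset.mem_filter, Finset.mem_univ, true_and]; omega
  have e4 : (Finset.univ.filter (fun y : s.Conf => s.rLab y = 0 + 1 ∧ 2 ≤ s.bLab y + 1)).card
      = (Finset.univ.filter (fun y : s.Conf => s.rLab y = 1 ∧ 1 ≤ s.bLab y)).card := by
    congr 1; ext y; simp only [Finset.mem_filter, Finset.mem_univ, true_and]; omega
  rw [e3, e4]; omega

end Counts

section Pointwise

/-- `psi 0 l r b` for `r = 0`: `−[l ≤ b]` -/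
lemma psi_zero_r0 (l r b : ℕ) (hr : r = 0) : psi 0 l r b = -(if l ≤ b then (1 : ℤ) else 0) := by
  unfold psi; split_ifs <;> omega

/-- `psi 0 l r b` for `r = 1`: `[l ≤ b+1]` -/
lemma psi_zero_r1 (l r b : ℕ) (hr : r = 1) : psi 0 l r b = (if l ≤ b + 1 then (1 : ℤ) else 0) := by
  unfold psi; split_ifs <;> omega

/-- `psi 0 l r b = 0` for `r ≥ 2` -/
lemma psi_zero_r2 (l r b : ℕ) (hr : 2 ≤ r) : psi 0 l r b = 0 := by
  unfold psi; split_ifs <;> omega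

/-- **the pointwise certificate of the parallel step of the row `i = 0`** (`j ≥ 2`): the weight of a sum of
labels dominates three products (count-valid weight of one factor) × (non-negative weight of the other) -/
theorem psi_zero_par_ge (j r b r' b' : ℕ) :
    (if r' = 0 ∧ b' + 1 ≤ j then (1 : ℤ) else 0) * psi 0 (j - b') r b
    + (if r' = 0 ∧ j ≤ b' then (1 : ℤ) else 0) * psi 0 j r b
    + (if r = 0 ∧ b + 1 ≤ j then (1 : ℤ) else 0) * psi 0 (j - b) r' b'
    ≤ psi 0 j (r + r') (b + b') := by
  rcases (by omega : r = 0 ∨ r = 1 ∨ 2 ≤ r) with hr | hr | hr <;>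
  rcases (by omega : r' = 0 ∨ r' = 1 ∨ 2 ≤ r') with hr' | hr' | hr'
  · simp only [psi_zero_r0 _ _ _ hr, psi_zero_r0 _ _ _ hr', psi_zero_r0 j (r + r') (b + b') (by omega)]
    simp (disch := omega) only [ mul_neg]
    split_ifs <;> omega
  · simp only [psi_zero_r0 _ _ _ hr, psi_zero_r1 _ _ _ hr', psi_zero_r1 j (r + r') (b + b') (by omega)]
    simp (disch := omega) only [ mul_neg]
    split_ifs <;> omega
  · simp only [psi_zero_r0 _ _ _ hr, psi_zero_r2 _ _ _ hr', psi_zero_r2 j (r + r') (b + b') (by omega)]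
    simp (disch := omega) only [if_neg, zero_mul, mul_neg, add_zero, neg_zero, mul_zero, le_refl]
  · simp only [psi_zero_r1 _ _ _ hr, psi_zero_r0 _ _ _ hr', psi_zero_r1 j (r + r') (b + b') (by omega)]
    simp (disch := omega) only [if_neg, zero_mul, mul_neg, add_zero, neg_zero]
    split_ifs <;> omega
  · simp only [psi_zero_r1 _ _ _ hr, psi_zero_r1 _ _ _ hr', psi_zero_r2 j (r + r') (b + b') (by omega)]
    simp (disch := omega) only [if_neg, zero_mul, add_zero, le_refl]
  · simp only [psi_zero_r1 _ _ _ hr, psi_zero_r2 _ _ _ hr', psi_zero_r2 j (r + r') (b + b') (by omega)]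
    simp (disch := omega) only [if_neg, zero_mul, add_zero, mul_zero, le_refl]
  · simp only [psi_zero_r2 _ _ _ hr, psi_zero_r0 _ _ _ hr', psi_zero_r2 j (r + r') (b + b') (by omega)]
    simp (disch := omega) only [if_neg, zero_mul, mul_neg, add_zero, neg_zero, mul_zero, le_refl]
  · simp only [psi_zero_r2 _ _ _ hr, psi_zero_r1 _ _ _ hr', psi_zero_r2 j (r + r') (b + b') (by omega)]
    simp (disch := omega) only [if_neg, zero_mul, add_zero, mul_zero, le_refl]
  · simp only [psi_zero_r2 _ _ _ hr, psi_zero_r2 _ _ _ hr', psi_zero_r2 j (r + r') (b + b') (by omega)]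
    simp (disch := omega) only [if_neg, add_zero, mul_zero, le_refl]

end Pointwise

section Product

variable (s t : V2Closure.SP)

/-- the STEP count of a series composition: `H''(i,j) = H₁(i,j)·T₂(i,j) + T₁(i+1,j)·H₂(i,j)` -/
lemma card_H_ser (i j : ℕ) :
    (Finset.univ.filter (fun y : (V2Closure.SP.ser s t).Conf =>
        (V2Closure.SP.ser s t).rLab y = i ∧ j ≤ (V2Closure.SP.ser s t).bLab y)).card
      = (Finset.univ.filter (fun y : s.Conf => s.rLab y = i ∧ j ≤ s.bLab y)).card
          * (Finset.univ.filter (fun y : t.Conf => i ≤ t.rLab y ∧ j ≤ t.bLab y)).card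
        + (Finset.univ.filter (fun y : s.Conf => i + 1 ≤ s.rLab y ∧ j ≤ s.bLab y)).card
          * (Finset.univ.filter (fun y : t.Conf => t.rLab y = i ∧ j ≤ t.bLab y)).card := by
  simp only [Finset.card_filter]
  rw [← sum_prod_ite s t (fun a => s.rLab a = i ∧ j ≤ s.bLab a) (fun c => i ≤ t.rLab c ∧ j ≤ t.bLab c),
    ← sum_prod_ite s t (fun a => i + 1 ≤ s.rLab a ∧ j ≤ s.bLab a) (fun c => t.rLab c = i ∧ j ≤ t.bLab c),
    ← Finset.sum_add_distrib]
  refine Finset.sum_congr rfl (fun y _ => ?_)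
  simp only [SP.rLab, SP.bLab, serR, serB]
  split_ifs <;> omega

/-- the series step of STEP(i, j): STEP of both factors and the anti-diagonal comparisons
`T₂(i,j) ≤ T₂(i+1,j−1)`, `T₁(i+1,j) ≤ T₁(i+2,j−1)` give STEP of the composition -/
lemma step_ser (i j : ℕ)
    (hs : (Finset.univ.filter (fun y : s.Conf => s.rLab y = i ∧ j ≤ s.bLab y)).card
      ≤ (Finset.univ.filter (fun y : s.Conf => s.rLab y = i + 1 ∧ j - 1 ≤ s.bLab y)).card)
    (ht : (Finset.univ.filter (fun y : t.Conf => t.rLab y = i ∧ j ≤ t.bLab y)).card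
      ≤ (Finset.univ.filter (fun y : t.Conf => t.rLab y = i + 1 ∧ j - 1 ≤ t.bLab y)).card)
    (hTt : (Finset.univ.filter (fun y : t.Conf => i ≤ t.rLab y ∧ j ≤ t.bLab y)).card
      ≤ (Finset.univ.filter (fun y : t.Conf => i + 1 ≤ t.rLab y ∧ j - 1 ≤ t.bLab y)).card)
    (hTs : (Finset.univ.filter (fun y : s.Conf => i + 1 ≤ s.rLab y ∧ j ≤ s.bLab y)).card
      ≤ (Finset.univ.filter (fun y : s.Conf => i + 1 + 1 ≤ s.rLab y ∧ j - 1 ≤ s.bLab y)).card) :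
    (Finset.univ.filter (fun y : (V2Closure.SP.ser s t).Conf =>
        (V2Closure.SP.ser s t).rLab y = i ∧ j ≤ (V2Closure.SP.ser s t).bLab y)).card
      ≤ (Finset.univ.filter (fun y : (V2Closure.SP.ser s t).Conf =>
        (V2Closure.SP.ser s t).rLab y = i + 1 ∧ j - 1 ≤ (V2Closure.SP.ser s t).bLab y)).card := by
  rw [card_H_ser, card_H_ser]
  exact Nat.add_le_add (Nat.mul_le_mul hs hTt) (Nat.mul_le_mul hTs ht)

/-- **the parallel step of the row `i = 0`** (`j ≥ 1`): the counts of `psi 0 l`, `1 ≤ l ≤ j`, non-negative on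
both factors ⟹ the count of `psi 0 j` non-negative on the parallel composition -/
theorem sum_psi_zero_par (j : ℕ) (hj : 1 ≤ j)
    (hs : ∀ l, 1 ≤ l → l ≤ j → 0 ≤ ∑ x, psi 0 l (s.rLab x) (s.bLab x))
    (ht : ∀ l, 1 ≤ l → l ≤ j → 0 ≤ ∑ y, psi 0 l (t.rLab y) (t.bLab y)) :
    0 ≤ ∑ p, psi 0 j ((V2Closure.SP.par s t).rLab p) ((V2Closure.SP.par s t).bLab p) := by
  have h1 := sum_prod_wt_fst s t (fun y => if t.rLab y = 0 ∧ t.bLab y + 1 ≤ j then (1 : ℤ) else 0)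
    (fun y => by split_ifs <;> simp) (fun y x => psi 0 (j - t.bLab y) (s.rLab x) (s.bLab x))
    (fun y hy => by
      split_ifs at hy with h
      · exact hs (j - t.bLab y) (by omega) (by omega)
      · exact absurd rfl hy)
  have h2 := sum_prod_wt_fst s t (fun y => if t.rLab y = 0 ∧ j ≤ t.bLab y then (1 : ℤ) else 0)
    (fun y => by split_ifs <;> simp) (fun _ x => psi 0 j (s.rLab x) (s.bLab x))
    (fun y hy => by
      split_ifs at hy with h
      · exact hs j (by omega) le_rfl
      · exact absurd rfl hy)
  have h3 := sum_prod_wt_snd s t (fun x => if s.rLab x = 0 ∧ s.bLab x + 1 ≤ j then (1 : ℤ) else 0)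
    (fun x => by split_ifs <;> simp) (fun x y => psi 0 (j - s.bLab x) (t.rLab y) (t.bLab y))
    (fun x hx => by
      split_ifs at hx with h
      · exact ht (j - s.bLab x) (by omega) (by omega)
      · exact absurd rfl hx)
  have key : ∀ p : s.Conf × t.Conf,
      (if t.rLab p.2 = 0 ∧ t.bLab p.2 + 1 ≤ j then (1 : ℤ) else 0) * psi 0 (j - t.bLab p.2) (s.rLab p.1) (s.bLab p.1)
      + (if t.rLab p.2 = 0 ∧ j ≤ t.bLab p.2 then (1 : ℤ) else 0) * psi 0 j (s.rLab p.1) (s.bLab p.1)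
      + (if s.rLab p.1 = 0 ∧ s.bLab p.1 + 1 ≤ j then (1 : ℤ) else 0) * psi 0 (j - s.bLab p.1) (t.rLab p.2) (t.bLab p.2)
      ≤ psi 0 j ((V2Closure.SP.par s t).rLab p) ((V2Closure.SP.par s t).bLab p) :=
    fun p => psi_zero_par_ge j (s.rLab p.1) (s.bLab p.1) (t.rLab p.2) (t.bLab p.2)
  calc (0 : ℤ) ≤ _ := add_nonneg (add_nonneg h1 h2) h3
    _ = ∑ p : s.Conf × t.Conf, (_ + _ + _) := by simp only [Finset.sum_add_distrib]
    _ ≤ ∑ p : s.Conf × t.Conf, psi 0 j ((V2Closure.SP.par s t).rLab p) ((V2Closure.SP.par s t).bLab p) :=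
        Finset.sum_le_sum (fun p _ => key p)

end Product

section Tails

variable (s : V2Closure.SP)

/-- `T(0,j) ≤ T(1,j−1)`: the axis theorem after the colour swap -/
lemma tail_zero_le (j : ℕ) (hj : 1 ≤ j) :
    (Finset.univ.filter (fun y : s.Conf => 0 ≤ s.rLab y ∧ j ≤ s.bLab y)).card
      ≤ (Finset.univ.filter (fun y : s.Conf => 0 + 1 ≤ s.rLab y ∧ j - 1 ≤ s.bLab y)).card := by
  have h := tail_axis_unimodal s (j - 1)
  rw [← card_swap s (fun r b => j - 1 + 1 ≤ r), ← card_swap s (fun r b => j - 1 ≤ r ∧ 1 ≤ b)] at h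
  have e1 : (Finset.univ.filter (fun y : s.Conf => 0 ≤ s.rLab y ∧ j ≤ s.bLab y))
      = Finset.univ.filter (fun y : s.Conf => j - 1 + 1 ≤ s.bLab y) := by
    ext y; simp only [Finset.mem_filter, Finset.mem_univ, true_and]; omega
  have e2 : (Finset.univ.filter (fun y : s.Conf => 0 + 1 ≤ s.rLab y ∧ j - 1 ≤ s.bLab y))
      = Finset.univ.filter (fun y : s.Conf => j - 1 ≤ s.bLab y ∧ 1 ≤ s.rLab y) := by
    ext y; simp only [Finset.mem_filter, Finset.mem_univ, true_and]; omega
  rw [e1, e2]; exact h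

/-- `T(1,j) ≤ T(2,j−1)`: the row `j = 1` after the colour swap (`j ≥ 3`), the swap itself at `j = 2` -/
lemma tail_one_le (j : ℕ) (hj : 2 ≤ j) :
    (Finset.univ.filter (fun y : s.Conf => 0 + 1 ≤ s.rLab y ∧ j ≤ s.bLab y)).card
      ≤ (Finset.univ.filter (fun y : s.Conf => 0 + 1 + 1 ≤ s.rLab y ∧ j - 1 ≤ s.bLab y)).card := by
  rcases (by omega : j = 2 ∨ 3 ≤ j) with h2 | h3
  · subst h2
    rw [← card_swap s (fun r b => 0 + 1 + 1 ≤ r ∧ 2 - 1 ≤ b)]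
    apply le_of_eq; congr 1; ext y; simp only [Finset.mem_filter, Finset.mem_univ, true_and]; omega
  · have h := t_row1 s j h3
    rw [← card_swap s (fun r b => j ≤ r ∧ 1 ≤ b), ← card_swap s (fun r b => j - 1 ≤ r ∧ 2 ≤ b)] at h
    have e1 : (Finset.univ.filter (fun y : s.Conf => 0 + 1 ≤ s.rLab y ∧ j ≤ s.bLab y))
        = Finset.univ.filter (fun y : s.Conf => j ≤ s.bLab y ∧ 1 ≤ s.rLab y) := by
      ext y; simp only [Finset.mem_filter, Finset.mem_univ, true_and]; omega
    have e2 : (Finset.univ.filter (fun y : s.Conf => 0 + 1 + 1 ≤ s.rLab y ∧ j - 1 ≤ s.bLab y))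
        = Finset.univ.filter (fun y : s.Conf => j - 1 ≤ s.bLab y ∧ 2 ≤ s.rLab y) := by
      ext y; simp only [Finset.mem_filter, Finset.mem_univ, true_and]; omega
    rw [e1, e2]; exact h

/-- the STEP count form with `j − 1 ≤ b` and the count of `psi` with `j ≤ b + 1` agree -/
lemma step_iff' (i j : ℕ) :
    (Finset.univ.filter (fun y : s.Conf => s.rLab y = i ∧ j ≤ s.bLab y)).card
        ≤ (Finset.univ.filter (fun y : s.Conf => s.rLab y = i + 1 ∧ j - 1 ≤ s.bLab y)).card
      ↔ 0 ≤ ∑ x, psi i j (s.rLab x) (s.bLab x) := by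
  rw [← step_iff]
  have e : (Finset.univ.filter (fun y : s.Conf => s.rLab y = i + 1 ∧ j - 1 ≤ s.bLab y))
      = Finset.univ.filter (fun y : s.Conf => s.rLab y = i + 1 ∧ j ≤ s.bLab y + 1) := by
    ext y; simp only [Finset.mem_filter, Finset.mem_univ, true_and]; omega
  rw [e]

end Tails

/-- the blue flow of an atom is `≤ 1` -/
lemma atom_bLab_le_one : ∀ (s : V2Closure.SP), (s = .free ∨ s = .pin ∨ s = .absent) → ∀ y : s.Conf, s.bLab y ≤ 1
  | .free, _, y => by cases y <;> simp [SP.bLab]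
  | .pin, _, _ => le_rfl
  | .absent, _, _ => by simp [SP.bLab]
  | .ser _ _, h, _ => by simp at h
  | .par _ _, h, _ => by simp at h

/-- **the row `i = 0` of STEP on every pattern of the grammar**: `#{r = 0 ∧ b ≥ j} ≤ #{r = 1 ∧ b ≥ j−1}` for
every `j ≥ 2` — a configuration with no red path and `j` disjoint blue paths is rarer than one with one
red path and `j−1` disjoint blue paths. -/
theorem step_row_zero : ∀ (s : V2Closure.SP) (j : ℕ), 2 ≤ j →
    (Finset.univ.filter (fun y : s.Conf => s.rLab y = 0 ∧ j ≤ s.bLab y)).card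
      ≤ (Finset.univ.filter (fun y : s.Conf => s.rLab y = 0 + 1 ∧ j - 1 ≤ s.bLab y)).card
  | .free, j, hj => by
    rw [Finset.card_eq_zero.2 (Finset.filter_eq_empty_iff.2 (fun y _ => by
      have := atom_bLab_le_one .free (Or.inl rfl) y; omega))]
    exact Nat.zero_le _
  | .pin, j, hj => by
    rw [Finset.card_eq_zero.2 (Finset.filter_eq_empty_iff.2 (fun y _ => by
      have := atom_bLab_le_one .pin (Or.inr (Or.inl rfl)) y; omega))]
    exact Nat.zero_le _
  | .absent, j, hj => by
    rw [Finset.card_eq_zero.2 (Finset.filter_eq_empty_iff.2 (fun y _ => by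
      have := atom_bLab_le_one .absent (Or.inr (Or.inr rfl)) y; omega))]
    exact Nat.zero_le _
  | .ser s t, j, hj =>
    step_ser s t 0 j (step_row_zero s j hj) (step_row_zero t j hj) (tail_zero_le t j (by omega)) (tail_one_le s j hj)
  | .par s t, j, hj => by
    refine (step_iff' (.par s t) 0 j).2 (sum_psi_zero_par s t j (by omega) ?_ ?_)
    · intro l hl hlj
      rcases (by omega : l = 1 ∨ 2 ≤ l) with h1 | h2
      · subst h1; rw [sum_psi_zero_one]; exact (step_iff' s 0 2).1 (step_row_zero s 2 le_rfl)
      · exact (step_iff' s 0 l).1 (step_row_zero s l h2)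
    · intro l hl hlj
      rcases (by omega : l = 1 ∨ 2 ≤ l) with h1 | h2
      · subst h1; rw [sum_psi_zero_one]; exact (step_iff' t 0 2).1 (step_row_zero t 2 le_rfl)
      · exact (step_iff' t 0 l).1 (step_row_zero t l h2)

/-- the same with `r = 1` written plainly -/
theorem step_row_zero' (s : V2Closure.SP) (j : ℕ) (hj : 2 ≤ j) :
    (Finset.univ.filter (fun y : s.Conf => s.rLab y = 0 ∧ j ≤ s.bLab y)).card
      ≤ (Finset.univ.filter (fun y : s.Conf => s.rLab y = 1 ∧ j - 1 ≤ s.bLab y)).card :=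
  step_row_zero s j hj

/-- the count form: `0 ≤ Σ psi 0 j` on every pattern for every `j ≥ 1` -/
theorem SP.sum_psi_zero_nonneg (s : V2Closure.SP) (j : ℕ) (hj : 1 ≤ j) :
    0 ≤ ∑ x, psi 0 j (s.rLab x) (s.bLab x) := by
  rcases (by omega : j = 1 ∨ 2 ≤ j) with h1 | h2
  · subst h1; rw [sum_psi_zero_one]; exact (step_iff' s 0 2).1 (step_row_zero s 2 le_rfl)
  · exact (step_iff' s 0 j).1 (step_row_zero s j h2)


end Summit.Ventures.PercRepro2.Tail2D
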